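import Summits.Parity.BatemanHorn.Theorems.SoloInformedRootLevelConstPos
import Mathlib.NumberTheory.Harmonic.Bounds

/-!
# Normalisation check: `A_X = 1` — the Dedekind–Landau constant of the linear polynomial `X` is `1`

Solo informed line (Parity / Bateman–Horn), session 136.  `A_g = rootLevelConst g` is DEFINED as a series over
squarefull moduli (`SoloInformedRootCountLevel`) and characterised by `∑_{d≤x} ρ_g(d)/d = A_g log x + O(1)`.  Here we
check the normalisation on the one case computable in closed form: for `g = X`, `ρ_X(d) = 1` for every `d ≥ 1`
(`polyRootCountMod_X`), so `∑_{d≤x} ρ_X(d)/d = H_x` is the harmonic number, `|H_x − log x| ≤ 1` (Mathlib's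
`harmonic_le_one_add_log`, `log_add_one_le_harmonic`), and the constant in `(const)·log x + O(1)` is unique
(`eq_of_abs_sub_mul_log_le`): hence `rootLevelConst X = 1` (`rootLevelConst_X`).
-/

open Finset Real Polynomial Filter Topology

namespace Summit.Parity.BatemanHorn.Theorems

open Literature.NumberTheory.Sieve

/-- `ρ_X(d) = 1` for `d ≥ 1`: the only root of `X` modulo `d` is `0`. -/
theorem polyRootCountMod_X {d : ℕ} (hd : 0 < d) : polyRootCountMod ![(X : ℤ[X])] d = 1 := by
  unfold polyRootCountMod
  rw [Finset.card_eq_one]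
  refine ⟨0, ?_⟩
  ext n
  simp only [Finset.mem_filter, Finset.mem_range, Finset.mem_singleton, Fin.prod_univ_one,
    Matrix.cons_val_zero, eval_X]
  constructor
  · rintro ⟨hn, hdvd⟩
    have h1 : d ∣ n := Int.natCast_dvd_natCast.mp hdvd
    rcases Nat.eq_zero_or_pos n with h | h
    · exact h
    · exact absurd (Nat.le_of_dvd h h1) (not_le.mpr hn)
  · rintro rfl
    exact ⟨hd, by simp⟩

/-- `∑_{d≤x} ρ_X(d)/d = H_x` (the harmonic number). -/
theorem polySmallLevel_X (x : ℕ) : polySmallLevel (X : ℤ[X]) x = (harmonic x : ℝ) := by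
  unfold polySmallLevel
  rw [harmonic_eq_sum_Icc, Rat.cast_sum]
  refine Finset.sum_congr rfl fun d hd => ?_
  have hd0 : 0 < d := (Finset.mem_Icc.mp hd).1
  rw [polyRootCountMod_X hd0]
  push_cast
  rw [one_div]

/-- `|H_x − log x| ≤ 1` for `x ≥ 1`. [folklore; Mathlib `harmonic_le_one_add_log`, `log_add_one_le_harmonic`] -/
theorem abs_harmonic_sub_log_le {x : ℕ} (hx : 1 ≤ x) : |(harmonic x : ℝ) - Real.log x| ≤ 1 := by
  have h1 := harmonic_le_one_add_log x
  have h2 := log_add_one_le_harmonic x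
  have hx0 : (0 : ℝ) < x := by exact_mod_cast hx
  have h3 : Real.log (x : ℝ) ≤ Real.log ((x + 1 : ℕ) : ℝ) :=
    Real.log_le_log hx0 (by push_cast; linarith)
  rw [abs_le]
  constructor <;> linarith

/-- **Uniqueness of the logarithmic constant**: if `|L(x) − A log x| ≤ K` and `|L(x) − A' log x| ≤ K'` for all `x ≥ 1`
then `A = A'`. [folklore] -/
theorem eq_of_abs_sub_mul_log_le {L : ℕ → ℝ} {A A' K K' : ℝ}
    (h : ∀ x : ℕ, 1 ≤ x → |L x - A * Real.log x| ≤ K) (h' : ∀ x : ℕ, 1 ≤ x → |L x - A' * Real.log x| ≤ K') :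
    A = A' := by
  by_contra hne
  have hδ : 0 < |A - A'| := abs_pos.mpr (sub_ne_zero.mpr hne)
  set B : ℝ := (K + K' + 1) / |A - A'| with hB
  obtain ⟨x, hxB, hx1⟩ : ∃ x : ℕ, B < Real.log (x : ℝ) ∧ 1 ≤ x := by
    refine ⟨⌈Real.exp B⌉₊ + 1, ?_, by omega⟩
    have h1 : Real.exp B < ((⌈Real.exp B⌉₊ + 1 : ℕ) : ℝ) := by
      have := Nat.le_ceil (Real.exp B)
      push_cast
      linarith
    calc B = Real.log (Real.exp B) := (Real.log_exp B).symm
      _ < Real.log (((⌈Real.exp B⌉₊ + 1 : ℕ) : ℝ)) := Real.log_lt_log (Real.exp_pos B) h1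
  have e1 := h x hx1
  have e2 := h' x hx1
  have hlog0 : 0 ≤ Real.log (x : ℝ) := Real.log_natCast_nonneg x
  -- `|A − A'| log x = |(L − A' log x) − (L − A log x)| ≤ K + K'`
  have h3 : |A - A'| * Real.log (x : ℝ) ≤ K + K' := by
    have : (A - A') * Real.log (x : ℝ) = (L x - A' * Real.log x) - (L x - A * Real.log x) := by ring
    rw [← abs_of_nonneg hlog0, ← abs_mul, this]
    exact (abs_sub _ _).trans (by linarith)
  have h4 : K + K' + 1 < |A - A'| * Real.log (x : ℝ) := by
    have := (div_lt_iff₀ hδ).mp hxB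
    linarith
  linarith

/-- **`A_X = 1`**: the Dedekind–Landau constant of the linear polynomial `X` is `1`. [this work] -/
theorem rootLevelConst_X : rootLevelConst (X : ℤ[X]) = 1 := by
  have hirr : Irreducible (X : ℤ[X]) := irreducible_X
  have hdeg : 0 < (X : ℤ[X]).natDegree := by rw [natDegree_X]; exact one_pos
  obtain ⟨K, hK⟩ := exists_abs_polySmallLevel_sub_log_le hirr hdeg
  refine eq_of_abs_sub_mul_log_le (L := fun x => polySmallLevel (X : ℤ[X]) x) (K := K) (K' := 1) hK ?_
  intro x hx
  rw [polySmallLevel_X, one_mul]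
  exact abs_harmonic_sub_log_le hx

/-- The level sum of `X` itself: `|∑_{d≤x} ρ_X(d)/d − log x| ≤ 1`, i.e. the `O(1)` of the general theorem is `≤ 1`
here. -/
theorem abs_polySmallLevel_X_sub_log_le {x : ℕ} (hx : 1 ≤ x) :
    |polySmallLevel (X : ℤ[X]) x - Real.log x| ≤ 1 := by
  rw [polySmallLevel_X]
  exact abs_harmonic_sub_log_le hx

end Summit.Parity.BatemanHorn.Theorems
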